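import Mathlib
import Summits.NavierStokesRegularity.NavierStokesRegularity.Theorems.WakeRatchetTailRatchetPostFiringClock
import HarnessLib

/-!
# `WakeRatchet.TailRatchet` (stmt-NavierStokesRegularity-21808), door D4′ — the FROZEN WAKE: post-firing decay (D′)
# follows from ONE simultaneous quiet time per firing (bounded delay)

Def-free support lemmas (MODEL lattice ODEs: the scalar dyadic member of Tao 2016 §1.2 / §4 in the renormalised
variables of §6.4; nothing here concerns the Navier–Stokes equations; stmt-21808 is neither proved nor refuted here and
no stub of skeleton d00b85951d7c is closed).  Same setting as `WakeRatchetTailRatchetPostFiringClock` (hypotheses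
explicit): `W_n' = −W_n + ΛW_{n−1}² − Λ⁻¹W_nW_{n+1}` on `σ > A₀`, `W ≥ 0` on `σ ≥ A`, shells below `0` vanish.

* `exp_mul_le_of_feed_decay` — variation of constants with an EXPONENTIALLY DECAYING feed: if the feed obeys
  `0 ≤ u ≤ m e^{−(σ−a)}` on `[a,b)` then `e^{σ−a} v(σ) ≤ v(a) + Λm²` on `[a,b]` (the drain only helps).
* `frozen_wake` — THE FROZEN-WAKE LEMMA: if at one log-time `σ₀ ≥ A` ALL shells `0 ≤ k ≤ n` are simultaneously below a
  level `η` with `4Λη ≤ 1`, then `W_k(σ) ≤ 2η e^{−(σ−σ₀)}` for every `k ≤ n` and every `σ ≥ σ₀` (induction up the block: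
  `m_k ≤ η + Λ m_{k−1}²` stays `≤ 2η`).  The lower block never re-activates: it is frozen in its `e^{−σ}` wake.
* `postFiringDecay_of_quietTimes` — hence the census estimate (D′) («`W_n(σ₁) ≥ c ⟹ W_n(σ₂) ≤ D e^{−(σ₂−σ₁)}`»,
  the single open clause of `WakeRatchetDyadicPostFiring.DyadicCauchyPostFiringBound`) FOLLOWS from a uniform bound
  `W ≤ B` (type I, in the tree for the Cauchy blow-up) and QUIET TIMES: every firing `W_n(σ₁) ≥ c` is followed within
  log-time `L` by an instant at which shells `0..n` are all `≤ η`; then `D = max(B, 2η)·e^{L}`.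

So the remaining analytic debt of door D4′ may be read as a LOCAL statement (bounded-delay simultaneous quietness of
the near wake) instead of a supremum over the whole future.  HONEST FRAMING: elementary real analysis on a MODEL
lattice; the quiet-time hypothesis is NOT proved here; rung 0.
-/

noncomputable section

set_option linter.dupNamespace false

namespace Summit.NavierStokesRegularity.NavierStokesRegularity.Theorems

namespace WakeRatchetDyadicPostFiring

open Set Filter Topology
open WakeRatchetFiringClock

variable {Λ : ℝ} {W : ℤ → ℝ → ℝ} {A₀ A B c : ℝ}

/-! ## Variation of constants with a decaying feed -/

/-- **Decaying feed.**  If `v' = −v + Λu² − Λ⁻¹vz` on `[a,b)` with `v, z ≥ 0` on `[a,b]`, `v` continuous on `[a,b]`,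
and the feed obeys `0 ≤ u(σ) ≤ m e^{−(σ−a)}` on `[a,b)`, then `e^{σ−a} v(σ) ≤ v(a) + Λ m²` for all `σ ∈ [a,b]`
(`g(σ) = e^{σ−a}v(σ) + Λm² e^{−(σ−a)}` is non-increasing).
[cite: Tao2016AveragedNS, §1.2 (dyadic model), §4 Lemma 4.1 (4.8) in the self-similar variables of §6.4; elementary] -/
theorem exp_mul_le_of_feed_decay (hΛ : 0 < Λ) {u v z : ℝ → ℝ} {a b m : ℝ}
    (hv : ∀ σ ∈ Ico a b, HasDerivAt v (-(v σ) + Λ * u σ ^ 2 - Λ⁻¹ * v σ * z σ) σ)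
    (hvc : ContinuousOn v (Icc a b)) (hv0 : ∀ σ ∈ Icc a b, 0 ≤ v σ) (hz0 : ∀ σ ∈ Icc a b, 0 ≤ z σ)
    (hu0 : ∀ σ ∈ Ico a b, 0 ≤ u σ) (hu : ∀ σ ∈ Ico a b, u σ ≤ m * Real.exp (-(σ - a))) :
    ∀ σ ∈ Icc a b, Real.exp (σ - a) * v σ ≤ v a + Λ * m ^ 2 := by
  set g : ℝ → ℝ := fun σ => Real.exp (σ - a) * v σ + Λ * m ^ 2 * Real.exp (-(σ - a)) with hg
  have hgc : ContinuousOn g (Icc a b) :=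
    ((Real.continuous_exp.comp (continuous_id.sub continuous_const)).continuousOn.mul hvc).add
      (continuousOn_const.mul (Real.continuous_exp.comp (continuous_id.sub continuous_const).neg).continuousOn)
  have hderiv : ∀ σ ∈ interior (Icc a b), HasDerivWithinAt g
      (Real.exp (σ - a) * (Λ * u σ ^ 2 - Λ⁻¹ * v σ * z σ) - Λ * m ^ 2 * Real.exp (-(σ - a)))
        (interior (Icc a b)) σ := by
    intro σ hσ
    rw [interior_Icc] at hσ
    have hσ' : σ ∈ Ico a b := ⟨hσ.1.le, hσ.2⟩
    have h1 : HasDerivAt (fun σ : ℝ => σ - a) 1 σ := (hasDerivAt_id' σ).sub_const a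
    have h2 : HasDerivAt (fun σ : ℝ => Real.exp (σ - a)) (Real.exp (σ - a) * 1) σ := h1.exp
    have h3 : HasDerivAt (fun σ : ℝ => Real.exp (-(σ - a))) (Real.exp (-(σ - a)) * (-1)) σ := h1.neg.exp
    have h4 := ((h2.mul (hv σ hσ')).add (h3.const_mul (Λ * m ^ 2)))
    refine (h4.congr_deriv ?_).hasDerivWithinAt
    ring
  have hnonpos : ∀ σ ∈ interior (Icc a b),
      Real.exp (σ - a) * (Λ * u σ ^ 2 - Λ⁻¹ * v σ * z σ) - Λ * m ^ 2 * Real.exp (-(σ - a)) ≤ 0 := by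
    intro σ hσ
    rw [interior_Icc] at hσ
    have hσ' : σ ∈ Ico a b := ⟨hσ.1.le, hσ.2⟩
    have hσ'' : σ ∈ Icc a b := ⟨hσ.1.le, hσ.2.le⟩
    have hdrain : 0 ≤ Λ⁻¹ * v σ * z σ := by
      have := hv0 σ hσ''; have := hz0 σ hσ''; have := inv_pos.2 hΛ
      positivity
    have hu2 : u σ ^ 2 ≤ (m * Real.exp (-(σ - a))) ^ 2 := pow_le_pow_left₀ (hu0 σ hσ') (hu σ hσ') 2
    have hexp : Real.exp (σ - a) * Real.exp (-(σ - a)) ^ 2 = Real.exp (-(σ - a)) := by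
      rw [sq, ← mul_assoc, ← Real.exp_add, ← Real.exp_add]
      congr 1; ring
    have he : 0 < Real.exp (σ - a) := Real.exp_pos _
    calc Real.exp (σ - a) * (Λ * u σ ^ 2 - Λ⁻¹ * v σ * z σ) - Λ * m ^ 2 * Real.exp (-(σ - a))
        ≤ Real.exp (σ - a) * (Λ * (m * Real.exp (-(σ - a))) ^ 2) - Λ * m ^ 2 * Real.exp (-(σ - a)) := by
          nlinarith [mul_le_mul_of_nonneg_left hu2 (mul_nonneg he.le hΛ.le)]
      _ = Λ * m ^ 2 * (Real.exp (σ - a) * Real.exp (-(σ - a)) ^ 2 - Real.exp (-(σ - a))) := by ring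
      _ = 0 := by rw [hexp, sub_self, mul_zero]
  have hanti : AntitoneOn g (Icc a b) :=
    antitoneOn_of_hasDerivWithinAt_nonpos (convex_Icc a b) hgc hderiv hnonpos
  intro σ hσ
  have hab : a ≤ b := hσ.1.trans hσ.2
  have h := hanti (left_mem_Icc.2 hab) hσ hσ.1
  simp only [hg, sub_self, Real.exp_zero, one_mul, neg_zero, mul_one] at h
  have hpos : 0 ≤ Λ * m ^ 2 * Real.exp (-(σ - a)) := by positivity
  linarith

/-! ## The frozen wake -/

/-- **FROZEN-WAKE LEMMA.**  Quiet start below shell `0`, non-negativity, and one SIMULTANEOUS quiet instant: if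
`W_k(σ₀) ≤ η` for all `0 ≤ k ≤ n` at some `σ₀ ≥ A`, with `0 ≤ η` and `4Λη ≤ 1`, then
`W_k(σ) ≤ 2η e^{−(σ−σ₀)}` for every `0 ≤ k ≤ n` and every `σ ≥ σ₀`.  (Induction up the block with
`exp_mul_le_of_feed_decay`: `m_k ≤ η + Λ m_{k−1}² ≤ η + 4Λη² ≤ 2η`.)
[cite: Tao2016AveragedNS, §1.2, §4 Lemma 4.1 (4.8), §6.4; elementary] -/
theorem frozen_wake (hΛ : 0 < Λ) (hA : A₀ < A)
    (hlaw : ∀ (n : ℤ) (σ : ℝ), A₀ < σ → HasDerivAt (W n)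
      (-(W n σ) + Λ * W (n - 1) σ ^ 2 - Λ⁻¹ * W n σ * W (n + 1) σ) σ)
    (hnn : ∀ (n : ℤ) (σ : ℝ), A ≤ σ → 0 ≤ W n σ)
    (hneg : ∀ n : ℤ, n < 0 → ∀ σ : ℝ, A ≤ σ → W n σ = 0)
    {η : ℝ} (hη : 0 ≤ η) (h4 : 4 * Λ * η ≤ 1) {σ₀ : ℝ} (hσ₀ : A ≤ σ₀) (n : ℕ)
    (hquiet : ∀ k : ℕ, k ≤ n → W k σ₀ ≤ η) :
    ∀ k : ℕ, k ≤ n → ∀ σ : ℝ, σ₀ ≤ σ → W k σ ≤ 2 * η * Real.exp (-(σ - σ₀)) := by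
  -- the stronger running form `e^{σ-σ₀} W_k(σ) ≤ 2η`
  have key : ∀ k : ℕ, k ≤ n → ∀ σ : ℝ, σ₀ ≤ σ → Real.exp (σ - σ₀) * W k σ ≤ 2 * η := by
    intro k
    induction k with
    | zero =>
      intro _ σ hσ
      -- feed `W (-1) ≡ 0`
      have h := exp_mul_le_of_feed_decay (m := 0) (a := σ₀) (b := σ) hΛ
        (u := W (0 - 1)) (v := W 0) (z := W (0 + 1))
        (fun τ hτ => hlaw 0 τ (hA.trans_le (hσ₀.trans hτ.1)))
        (continuousOn_Icc hlaw 0 (hA.trans_le hσ₀))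
        (fun τ hτ => hnn _ τ (hσ₀.trans hτ.1)) (fun τ hτ => hnn _ τ (hσ₀.trans hτ.1))
        (fun τ hτ => hnn _ τ (hσ₀.trans hτ.1))
        (fun τ hτ => by rw [hneg (0 - 1) (by norm_num) τ (hσ₀.trans hτ.1)]; positivity)
        σ (right_mem_Icc.2 hσ)
      have h0 : W ((0 : ℕ) : ℤ) σ₀ ≤ η := hquiet 0 (Nat.zero_le n)
      push_cast at h0 ⊢
      nlinarith [h, h0]
    | succ k ih =>
      intro hk σ hσ
      have ih' : ∀ τ : ℝ, σ₀ ≤ τ → Real.exp (τ - σ₀) * W k τ ≤ 2 * η := ih (Nat.le_of_succ_le hk)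
      have hfeed : ∀ τ ∈ Ico σ₀ σ, W ((k : ℤ) + 1 - 1) τ ≤ 2 * η * Real.exp (-(τ - σ₀)) := by
        intro τ hτ
        rw [add_sub_cancel_right]
        have h1 := ih' τ hτ.1
        have he : 0 < Real.exp (τ - σ₀) := Real.exp_pos _
        rw [Real.exp_neg, ← div_eq_mul_inv, le_div_iff₀ he]
        linarith
      have h := exp_mul_le_of_feed_decay (m := 2 * η) (a := σ₀) (b := σ) hΛ
        (u := W ((k : ℤ) + 1 - 1)) (v := W ((k : ℤ) + 1)) (z := W ((k : ℤ) + 1 + 1))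
        (fun τ hτ => hlaw _ τ (hA.trans_le (hσ₀.trans hτ.1)))
        (continuousOn_Icc hlaw _ (hA.trans_le hσ₀))
        (fun τ hτ => hnn _ τ (hσ₀.trans hτ.1)) (fun τ hτ => hnn _ τ (hσ₀.trans hτ.1))
        (fun τ hτ => hnn _ τ (hσ₀.trans hτ.1)) hfeed σ (right_mem_Icc.2 hσ)
      have h0 : W ((k + 1 : ℕ) : ℤ) σ₀ ≤ η := hquiet (k + 1) hk
      push_cast at h0 ⊢
      have h4' : Λ * (2 * η) ^ 2 ≤ η := by nlinarith
      linarith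
  intro k hk σ hσ
  have h := key k hk σ hσ
  have he : 0 < Real.exp (σ - σ₀) := Real.exp_pos _
  rw [Real.exp_neg, ← div_eq_mul_inv, le_div_iff₀ he]
  linarith

/-! ## (D′) from quiet times -/

/-- **Post-firing decay from bounded-delay quiet times.**  With a uniform bound `W ≤ B` on `σ ≥ A` and the FROZEN
WAKE: if every firing `W_n(σ₁) ≥ c` (`σ₁ ≥ A`, `n ≥ 0`) is followed within log-time `L` by an instant `σ₀` at which
all shells `0..n` are `≤ η` (`0 ≤ η`, `4Λη ≤ 1`), then the post-firing decay (D′) holds with `D = max(B, 2η)·e^{L}`: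
`W_n(σ₂) ≤ D e^{−(σ₂−σ₁)}` for all `σ₂ ≥ σ₁` (every `n ∈ ℤ`; shells below `0` vanish).
[cite: Tao2016AveragedNS, §1.2, §4 Lemma 4.1 (4.8), §6.4; elementary] -/
theorem postFiringDecay_of_quietTimes (hΛ : 0 < Λ) (hA : A₀ < A)
    (hlaw : ∀ (n : ℤ) (σ : ℝ), A₀ < σ → HasDerivAt (W n)
      (-(W n σ) + Λ * W (n - 1) σ ^ 2 - Λ⁻¹ * W n σ * W (n + 1) σ) σ)
    (hnn : ∀ (n : ℤ) (σ : ℝ), A ≤ σ → 0 ≤ W n σ) (hB : ∀ (n : ℤ) (σ : ℝ), A ≤ σ → W n σ ≤ B)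
    (hneg : ∀ n : ℤ, n < 0 → ∀ σ : ℝ, A ≤ σ → W n σ = 0)
    {η L : ℝ} (hη : 0 ≤ η) (h4 : 4 * Λ * η ≤ 1)
    (hQT : ∀ (n : ℕ) (σ₁ : ℝ), A ≤ σ₁ → c ≤ W n σ₁ →
      ∃ σ₀ : ℝ, σ₁ ≤ σ₀ ∧ σ₀ ≤ σ₁ + L ∧ ∀ k : ℕ, k ≤ n → W k σ₀ ≤ η) :
    ∀ (n : ℤ) (σ₁ σ₂ : ℝ), A ≤ σ₁ → σ₁ ≤ σ₂ → c ≤ W n σ₁ →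
      W n σ₂ ≤ max B (2 * η) * Real.exp L * Real.exp (-(σ₂ - σ₁)) := by
  intro n σ₁ σ₂ hσ₁ h12 hfire
  have hB0 : 0 ≤ B := (hnn 0 σ₁ hσ₁).trans (hB 0 σ₁ hσ₁)
  have hM0 : 0 ≤ max B (2 * η) := hB0.trans (le_max_left _ _)
  rcases lt_or_ge n 0 with hn | hn
  · rw [hneg n hn σ₂ (hσ₁.trans h12)]
    positivity
  · obtain ⟨k, rfl⟩ : ∃ k : ℕ, (k : ℤ) = n := ⟨n.toNat, Int.toNat_of_nonneg hn⟩
    obtain ⟨σ₀, h10, h0L, hquiet⟩ := hQT k σ₁ hσ₁ hfire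
    have hσ₀ : A ≤ σ₀ := hσ₁.trans h10
    -- `e^{L} e^{-(σ₂-σ₁)} ≥ e^{-(σ₂-σ₀)}` and `≥ 1` when `σ₂ ≤ σ₀`
    rcases le_or_gt σ₂ σ₀ with hcase | hcase
    · -- before the quiet time: the uniform bound
      have h1 : 1 ≤ Real.exp L * Real.exp (-(σ₂ - σ₁)) := by
        rw [← Real.exp_add]
        exact Real.one_le_exp (by linarith)
      calc W (k : ℤ) σ₂ ≤ B := hB _ σ₂ (hσ₁.trans h12)
        _ ≤ max B (2 * η) := le_max_left _ _
        _ ≤ max B (2 * η) * (Real.exp L * Real.exp (-(σ₂ - σ₁))) :=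
            le_mul_of_one_le_right hM0 h1
        _ = max B (2 * η) * Real.exp L * Real.exp (-(σ₂ - σ₁)) := by ring
    · -- after the quiet time: the frozen wake
      have hfw := frozen_wake hΛ hA hlaw hnn hneg hη h4 hσ₀ k hquiet k le_rfl σ₂ hcase.le
      have h2 : Real.exp (-(σ₂ - σ₀)) ≤ Real.exp L * Real.exp (-(σ₂ - σ₁)) := by
        rw [← Real.exp_add]
        exact Real.exp_le_exp.2 (by linarith)
      calc W (k : ℤ) σ₂ ≤ 2 * η * Real.exp (-(σ₂ - σ₀)) := hfw
        _ ≤ max B (2 * η) * Real.exp (-(σ₂ - σ₀)) :=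
            mul_le_mul_of_nonneg_right (le_max_right _ _) (Real.exp_pos _).le
        _ ≤ max B (2 * η) * (Real.exp L * Real.exp (-(σ₂ - σ₁))) :=
            mul_le_mul_of_nonneg_left h2 hM0
        _ = max B (2 * η) * Real.exp L * Real.exp (-(σ₂ - σ₁)) := by ring

end WakeRatchetDyadicPostFiring

end Summit.NavierStokesRegularity.NavierStokesRegularity.Theorems

end
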